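import Literature.NumberTheory.GaloisRepresentations.ResidualPair
import Literature.NumberTheory.GaloisRepresentations.FramedRepBlockSum
import HarnessLib

/-!
# `HasResidualPair ρ red σ σ'` gives `HasResidualSemisimplification ρ red (σ ⊞ σ')`

Topic `Literature/NumberTheory/GaloisRepresentations`; a theorems-only bridge between
`ResidualPair.lean` (`FramedGaloisRep.HasResidualPair`, `HasResidualSemisimplification`: residual
semisimplifications read off Frobenius characteristic polynomials, Deligne–Serre 1974 §6) and the
block sum `σ ⊞ σ'` of framed Galois representations (`FramedGaloisRep.blockSum`,
`FramedRepBlockSum.lean`).  `ResidualPair.lean` lists "the block-sum `σ ⊕ σ'` as a framed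
representation (then `HasResidualPair ↔ HasResidualSemisimplification` …)" as deliberately not
there; this file supplies the forward comparison, kept in a separate leaf so that neither
`ResidualPair.lean` nor its importers change:

* `HasResidualPair.hasResidualSemisimplification_blockSum` — for `ρ` of rank `a + b`,
  `HasResidualPair ρ red σ σ' → HasResidualSemisimplification ρ red (σ ⊞ σ')`
  (`IsUnramifiedAt.blockSum`, `HasFrobCharpolyAt.blockSum`);
* `HasResidualPair.hasResidualSemisimplification_reindex_blockSum` — the same for `ρ` of rank `n`
  with `a + b = n`, the block sum cast to rank `n` by `FramedRep.reindex (finCongr _)`.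

Deliberately NOT here: the converse (it needs the Frobenius characteristic polynomials of `σ` and
`σ'` separately at the places where `σ ⊞ σ'` is unramified, i.e. `hasFrobCharpolyAt_frobCharpoly`
for a number field `K`, whereas `HasResidualPair` is stated for any field `K`).

## References
* P. Deligne, J.-P. Serre, Formes modulaires de poids 1, Ann. Sci. ÉNS 7 (1974), §6. [DeligneSerre1974]
* J.-P. Serre, *Linear representations of finite groups* (1977), §1.3 (b), §2.1. [SerreLinearRepresentations1977]
-/

noncomputable section

open IsDedekindDomain Filter
open scoped NumberField

namespace Literature.NumberTheory.GaloisRepresentations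

namespace FramedGaloisRep

variable {K : Type} [Field K] {p : ℕ} [Fact p.Prime]
variable {k : Type*} [Field k] [TopologicalSpace k]
variable {n a b : ℕ} {red : Valued.integer (PadicAlgCl p) →+* k}
  {σ : FramedGaloisRep K k a} {σ' : FramedGaloisRep K k b}

/-- **`ρ̄^{ss} ≅ σ ⊕ σ'` gives `ρ̄^{ss} ≅ (σ ⊞ σ')^{ss}`**: if `ρ` (of rank `a + b`) has the residual
pair `(σ, σ')` in the sense of `HasResidualPair` (at almost all `v`: all three unramified, and the
integral Frobenius characteristic polynomial of `ρ` reduces to the product of those of `σ`, `σ'`),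
then it has residual semisimplification the block sum `σ ⊞ σ'` (`FramedGaloisRep.blockSum`:
unramified where both are, Frobenius characteristic polynomial the product —
`IsUnramifiedAt.blockSum`, `HasFrobCharpolyAt.blockSum`). [folklore] -/
theorem HasResidualPair.hasResidualSemisimplification_blockSum
    {ρ : FramedGaloisRep K (PadicAlgCl p) (a + b)} (h : ρ.HasResidualPair red σ σ') :
    ρ.HasResidualSemisimplification red (σ.blockSum σ') := by
  refine h.mono fun v hv => ?_
  obtain ⟨hρ, hσ, hσ', P, P₁, P₂, hP, hP₁, hP₂, hred⟩ := hv
  exact ⟨hρ, hσ.blockSum hσ', P, P₁ * P₂, hP, hP₁.blockSum hP₂, hred⟩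

/-- The same for `ρ` of rank `n` with `hn : a + b = n`, the block sum `σ ⊞ σ'` being cast to rank
`n` along `FramedRep.reindex (finCongr hn)` (`isUnramifiedAt_reindex_iff`,
`hasFrobCharpolyAt_reindex_iff`). [folklore] -/
theorem HasResidualPair.hasResidualSemisimplification_reindex_blockSum
    {ρ : FramedGaloisRep K (PadicAlgCl p) n} (hn : a + b = n) (h : ρ.HasResidualPair red σ σ') :
    ρ.HasResidualSemisimplification red (FramedRep.reindex (finCongr hn) (σ.blockSum σ')) := by
  refine h.mono fun v hv => ?_
  obtain ⟨hρ, hσ, hσ', P, P₁, P₂, hP, hP₁, hP₂, hred⟩ := hv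
  exact ⟨hρ, (isUnramifiedAt_reindex_iff v _ _).2 (hσ.blockSum hσ'), P, P₁ * P₂, hP,
    (hasFrobCharpolyAt_reindex_iff v _ _ _).2 (hP₁.blockSum hP₂), hred⟩

end FramedGaloisRep

end Literature.NumberTheory.GaloisRepresentations
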